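import Mathlib
import HarnessLib
import Summits.HubbardSuperconductivity.HubbardSuperconductivity.Theorems.KLProgrammeKLRegimeEnginePairLadderTowerRecentred
import Summits.HubbardSuperconductivity.HubbardSuperconductivity.Theorems.KLProgrammeKLRegimeEnginePairTransferMemberFlow
import Summits.HubbardSuperconductivity.HubbardSuperconductivity.Theorems.KLProgrammeKLRegimeSplitEdgeFactsSliceLines

/-!
# Route `KLProgramme` — crux K3 ENGINE (stmt-HubbardSuperconductivity-20437 `KLRegimeEngineV17F2`), row (c) `stub_engine_step_values`, binder #8 `hexLadPkg`:
# the single-member RESOLVENT TOWER BY NAME — **`klmt_memberTower_keyed`** — and the `htower`-shaped package of the PLAIN member — **`klmt_htower_plain`**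
# (cell gate-hubbard-kl, seat hubbard-kl-k3c1-p1 g24, technique «composed-map remainder propagation»; item «ROW-(c)-HTOWER-BY-TYPE»; sequel of …PairLadderTowerRecentred)

WHY.  Binder #8 `hexLadPkg` of the pin (E1-LEDGER-AT-KILL §1 #8; closer `EngineV8.rowC_hexLad_of_pkg`, consumer `EngineV8.pairLadderStepAtV17F2_of_relFamilyK5_klCT8`)
asks class #5 for the RESOLVENT-TOWER package `htower`: per in-class `Qm`, a Neumann inverse `Nm` of `1 + diag w₁·X` at the HISTORY member `X` (the ball array of
`klCovSmearedPairAmplitude … (Kₙ₋₁) (n−1) (softCovOf … s_(n−1,n))`), an error row `‖klPairArrayF n − X·Nm‖ ≤ Ea` on the bare ball, the mass / smallness / sign lines of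
`w₁`, and the slot row.  Nobody produced it (E1-LEDGER #8: «htower/hC₀/hsm₀ typing 1–2 sd»).  This file types it, keyed `(n, n+1)` like the class-#5 STEP of record
(`pairTransferRelRes_succ_keyed_resolved`, …RelResStepResolved) and in the SAME supplier currency:
* **`klmt_memberTower_keyed`** (§1) — for ANY member `ψ` at scale `n+1` (frame `K_(n+1)`) and ANY history array `X = klMemberArrayF … n χ Qm`: the pinned member curve
  `A Qm t` / its bilinear derivative `A′ Qm t` / the aggregated rung `b Qm t` and its rate `b′ Qm t` are PINNED BY EQUATIONS (the four equations of the resolved step,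
  one member; pass `rfl`); the calculus is `klmf_memberArray_flowData` + `klmf_rung_data` (…MemberFlow; needs `Z^(K_(n+1)) ≠ 0` on the slice); the sizes are
  {a priori `‖A Qm t‖ ≤ m`; INTEGRATED RATE PROFILE `∫₀¹‖b′ Qm τ c‖dτ ≤ ρ c` with `(3/2)·m·Σρ ≤ 1/3`; history a priori `‖X‖ ≤ m`; the (F)(i) START ROW
  `‖A Qm 0 − X‖ ≤ η ≤ r′`; `(3/2·m + r′)·Σ_p |w₁ p| ≤ 1/3` for the NAMED weight `w₁ = klSliceWeightSmeared … (K_(n+1)) (n+1) ψ Qm`; the single-member RESOLVED source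
  integral `I ≥ ∫₀¹‖(A′ + A·diag b′·A)(t)‖` (= the pinned Riccati defect of `klmd_pinnedDefect_eq_resolved`'s currency); ONE majorant row `E ≥ FT_ρ(I) + FT_(|w₁|)(η)`};
  OUTPUT `∃ Nm`, two-sided inverse of `1 + diag w₁·X`, `‖klMemberArrayF (n+1) ψ Qm − X·Nm‖ ≤ E Qm` on the bare ball — by `kltc_tower_recentred`.
* `klmt_sliceWeight_massLine` / `klmt_sliceWeight_signLine` (§2) — the tower weight's lines in `htower`'s shape: `Σ|w₁| ≤ ¾·G.bhi` and `Σ(|w₁| − w₁) ≤ klEdge G (n+1) |Qm|_𝕋`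
  (NO factor 2) on an admissible frame with `klBetaMin ≤ β ≤ L`, for an admissible member symbol, as soon as `2¹⁹ ≤ G.bhi` (`sum_abs_klSliceWeightSmeared_succ_le` gives `2¹⁸`;
  `klSliceWeightSmeared_succ_nonneg_of_deep` the deep sign; `klEngGeo14.bhi = 2²⁴`).
* **`klmt_htower_plain`** (§3) — the PLAIN member `ψ = 0` (`klMemberArrayF_zero`: its array IS `klPairArrayF (n+1)`), history `χ = s^(Kₙ)_(n,n+1)`: from the §1 sizes plus the
  consumer-side rows {`Tb Qm ≤ r′`, `E₁ ≥ Ea + FT_(|w₁|)(Tb Qm)`, `E₁ ≤ e₁`, the slot row `E₁ ≤ Bar Qm` on the ball} at a GENERIC bar `Tb` and slot `Bar`, the fourteen-conjunct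
  `htower` package VERBATIM at keying `(n, n+1)` (read `…_of_relFamilyK5_klCT8`'s `(n−1, n)`; `Tb Qm := transferBarRelIdx L Gth P (klCT8 …) β U n n Qm`, `Bar Qm k k′ :=`
  the six-slot bar line) — X-rows, `0 ≤ Ea`, Neumann, error, mass and sign lines DISCHARGED; what the supplier owes is sizes only.
Plumbing + real analysis over landed doors; nothing about the model's sizes is asserted; nothing asserts (c), any stub of 20437, K3, U₀, the window or superconductivity.  0 kit · 0 lit.
-/

noncomputable section

namespace Summit.HubbardSuperconductivity.HubbardSuperconductivity.Theorems.KLRegimeSplit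

set_option linter.dupNamespace false -- summit = problem name (single-conjunct summit), D-0017

open Finset Matrix Set Literature.MathematicalPhysics.QuantumLattice Literature.Probability.LatticeModels GrassmannAlgebra
open Summit.HubbardSuperconductivity.HubbardSuperconductivity.Theorems.KLProgrammeCooperResummation
open Summit.HubbardSuperconductivity.HubbardSuperconductivity.Theorems.KLProgrammeLegKernels
open Summit.HubbardSuperconductivity.HubbardSuperconductivity.Theorems.DispersionFlow
open Summit.HubbardSuperconductivity.HubbardSuperconductivity.Theorems.KLRegimeWick

/-! ## §1 The single-member tower by name -/

section Keyed

variable (L M : ℕ) [NeZero L] [NeZero M]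

set_option maxHeartbeats 1600000 in -- long pinning equations; plumbing into `kltc_tower_recentred`
/-- **`klmt_memberTower_keyed`** — the resolvent tower of ONE member `ψ` along slice `n+1`, re-centred at a history array `klMemberArrayF … n χ Qm` (see the module
docstring).  `A A′ b b′` are PINNED by the four equations (pass `rfl`); the conclusion's weight is `klSliceWeightSmeared … (K_(n+1)) (n+1) ψ Qm` BY NAME. -/
theorem klmt_memberTower_keyed {β U μ : ℝ} {n : ℕ} {m : ℝ} (hm : 0 ≤ m) {ψ χ : FreqMomentum L M → ℝ}
    (hZ : ∀ Λ ∈ Icc (klScale klE0 (n + 1)) (klScale klE0 n), hubbardEffPartitionFnCT L M β U μ 0 (klFlowFrameU L M β U μ (n + 1)) Λ ≠ 0)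
    (A A' : TorusSite 2 L → ℝ → Matrix (TorusSite 2 L) (TorusSite 2 L) ℂ) (b b' : TorusSite 2 L → ℝ → TorusSite 2 L → ℂ)
    (hAdef : A = fun Qm t => Matrix.of fun k k' : TorusSite 2 L => if k ∈ klBall L μ 0 ∧ k' ∈ klBall L μ 0 then
      vertexFn L M β (gaussConv ℂ
        (softCovOf L M β μ (klFlowFrameU L M β U μ (n + 1)) ψ + hubbardCovAboveCT L M β μ 0 (klFlowFrameU L M β U μ (n + 1)) (klScale klE0 (n + 1)) -
          hubbardCovAboveCT L M β μ 0 (klFlowFrameU L M β U μ (n + 1)) (klScale klE0 n + t * (klScale klE0 (n + 1) - klScale klE0 n)))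
        (hubbardEffectiveActionCT L M β U μ 0 (klFlowFrameU L M β U μ (n + 1)) (klScale klE0 n + t * (klScale klE0 (n + 1) - klScale klE0 n)))) 4
        ![(((omega0 M, k'), 0), 0), ((((omega0 M).rev, Qm - k'), 1), 0), ((((omega0 M).rev, Qm - k), 1), 1), (((omega0 M, k), 0), 1)]
      else 0)
    (hA'def : A' = fun Qm t => Matrix.of fun k k' : TorusSite 2 L => if k ∈ klBall L μ 0 ∧ k' ∈ klBall L μ 0 then
      (klScale klE0 (n + 1) - klScale klE0 n) • -((2 : ℂ)⁻¹ * vertexFn L M β (gaussConv ℂ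
        (softCovOf L M β μ (klFlowFrameU L M β U μ (n + 1)) ψ + hubbardCovAboveCT L M β μ 0 (klFlowFrameU L M β U μ (n + 1)) (klScale klE0 (n + 1)) -
          hubbardCovAboveCT L M β μ 0 (klFlowFrameU L M β U μ (n + 1)) (klScale klE0 n + t * (klScale klE0 (n + 1) - klScale klE0 n)))
        (grassmannDerivPairing ℂ
          (Matrix.of fun X Y : HubbardFieldIdx L M => deriv (fun Λ'' : ℝ => hubbardCovAboveCT L M β μ 0 (klFlowFrameU L M β U μ (n + 1)) Λ'' X Y)
            (klScale klE0 n + t * (klScale klE0 (n + 1) - klScale klE0 n)))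
          (hubbardEffectiveActionCT L M β U μ 0 (klFlowFrameU L M β U μ (n + 1)) (klScale klE0 n + t * (klScale klE0 (n + 1) - klScale klE0 n)))
          (hubbardEffectiveActionCT L M β U μ 0 (klFlowFrameU L M β U μ (n + 1)) (klScale klE0 n + t * (klScale klE0 (n + 1) - klScale klE0 n))))) 4
        ![(((omega0 M, k'), 0), 0), ((((omega0 M).rev, Qm - k'), 1), 0), ((((omega0 M).rev, Qm - k), 1), 1), (((omega0 M, k), 0), 1)])
      else 0)
    (hbdef : b = fun Qm t p => -((klBubbleMass L M β μ (klFlowFrameU L M β U μ (n + 1))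
        (fun k => ψ k + (hubbardCutoffWeightCT L M β μ (klFlowFrameU L M β U μ (n + 1)) (klScale klE0 (n + 1)) k -
          hubbardCutoffWeightCT L M β μ (klFlowFrameU L M β U μ (n + 1)) (klScale klE0 n + t * (klScale klE0 (n + 1) - klScale klE0 n)) k))
        (fun k => ψ k + (hubbardCutoffWeightCT L M β μ (klFlowFrameU L M β U μ (n + 1)) (klScale klE0 (n + 1)) k -
          hubbardCutoffWeightCT L M β μ (klFlowFrameU L M β U μ (n + 1)) (klScale klE0 n + t * (klScale klE0 (n + 1) - klScale klE0 n)) k)) Qm p : ℝ) : ℂ))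
    (hb'def : b' = fun Qm t p => (((klScale klE0 (n + 1) - klScale klE0 n) *
        (klBubbleMass L M β μ (klFlowFrameU L M β U μ (n + 1))
            (fun k => deriv (fun Λ' => hubbardCutoffWeightCT L M β μ (klFlowFrameU L M β U μ (n + 1)) Λ' k) (klScale klE0 n + t * (klScale klE0 (n + 1) - klScale klE0 n)))
            (fun k => ψ k + (hubbardCutoffWeightCT L M β μ (klFlowFrameU L M β U μ (n + 1)) (klScale klE0 (n + 1)) k -
          hubbardCutoffWeightCT L M β μ (klFlowFrameU L M β U μ (n + 1)) (klScale klE0 n + t * (klScale klE0 (n + 1) - klScale klE0 n)) k)) Qm p +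
          klBubbleMass L M β μ (klFlowFrameU L M β U μ (n + 1))
            (fun k => ψ k + (hubbardCutoffWeightCT L M β μ (klFlowFrameU L M β U μ (n + 1)) (klScale klE0 (n + 1)) k -
          hubbardCutoffWeightCT L M β μ (klFlowFrameU L M β U μ (n + 1)) (klScale klE0 n + t * (klScale klE0 (n + 1) - klScale klE0 n)) k))
            (fun k => deriv (fun Λ' => hubbardCutoffWeightCT L M β μ (klFlowFrameU L M β U μ (n + 1)) Λ' k) (klScale klE0 n + t * (klScale klE0 (n + 1) - klScale klE0 n)))
            Qm p) : ℝ) : ℂ))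
    (Qm : TorusSite 2 L) {r' : ℝ} (hr' : 0 ≤ r') (ρ : TorusSite 2 L → ℝ) (η I E : TorusSite 2 L → TorusSite 2 L → ℝ)
    -- a priori size of the member array along the slice
    (hAm : ∀ t ∈ Icc (0 : ℝ) 1, ∀ x y, ‖A Qm t x y‖ ≤ m)
    -- INTEGRATED RATE PROFILE of the rung weight and its smallness (in the model `ρ := klRungProfile …`, `klmf_integral_norm_rate_le_klRungProfile`)
    (hV : ∀ c, (∫ τ in (0 : ℝ)..1, ‖b' Qm τ c‖) ≤ ρ c) (hsm : 3 / 2 * m * ∑ c, ρ c ≤ 1 / 3)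
    -- the history array's a priori size and the START RE-FRAME row ((F)(i) lane) with its scalar cap
    (hXm : ∀ x y, ‖klMemberArrayF L M β U μ n χ Qm x y‖ ≤ m)
    (hη0 : ∀ x y, 0 ≤ η x y) (hη : ∀ x y, ‖(A Qm 0 - klMemberArrayF L M β U μ n χ Qm) x y‖ ≤ η x y) (hηe : ∀ x y, η x y ≤ r')
    -- smallness of the NAMED tower weight against the re-centred a priori size
    (hsm₁ : (3 / 2 * m + r') * ∑ p, |klSliceWeightSmeared L M β μ (klFlowFrameU L M β U μ (n + 1)) (n + 1) ψ Qm p| ≤ 1 / 3)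
    -- the RESOLVED slice integral of the member's Riccati defect (`klmd_pinnedDefect_eq_resolved`'s currency)
    (hI : ∀ x y, (∫ t in (0 : ℝ)..1, ‖(A' Qm t + A Qm t * diagonal (b' Qm t) * A Qm t) x y‖) ≤ I x y)
    -- ONE majorant row: source four-term + re-centring four-term
    (hE : ∀ x y,
      (I x y + 3 / 2 * (3 / 2 * m) * ∑ c, I x c * ρ c + 3 / 2 * m * ∑ a, ρ a * I a y +
            9 / 4 * m * (3 / 2 * m) * ∑ a, ∑ c, ρ a * I a c * ρ c) +
        (η x y + 3 / 2 * (3 / 2 * m) * ∑ t, η x t * |klSliceWeightSmeared L M β μ (klFlowFrameU L M β U μ (n + 1)) (n + 1) ψ Qm t| + 3 / 2 * (3 / 2 * m + r') * ∑ a, |klSliceWeightSmeared L M β μ (klFlowFrameU L M β U μ (n + 1)) (n + 1) ψ Qm a| * η a y +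
            9 / 4 * (3 / 2 * m + r') * (3 / 2 * m) * ∑ a, ∑ t, |klSliceWeightSmeared L M β μ (klFlowFrameU L M β U μ (n + 1)) (n + 1) ψ Qm a| * η a t * |klSliceWeightSmeared L M β μ (klFlowFrameU L M β U μ (n + 1)) (n + 1) ψ Qm t|) ≤ E x y) :
    ∃ Nm : Matrix (TorusSite 2 L) (TorusSite 2 L) ℂ,
      (1 + diagonal (fun p => ((klSliceWeightSmeared L M β μ (klFlowFrameU L M β U μ (n + 1)) (n + 1) ψ Qm p : ℝ) : ℂ)) * klMemberArrayF L M β U μ n χ Qm) * Nm = 1 ∧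
      Nm * (1 + diagonal (fun p => ((klSliceWeightSmeared L M β μ (klFlowFrameU L M β U μ (n + 1)) (n + 1) ψ Qm p : ℝ) : ℂ)) * klMemberArrayF L M β U μ n χ Qm) = 1 ∧
      ∀ k ∈ klBall L μ 0, ∀ k' ∈ klBall L μ 0, ‖klMemberArrayF L M β U μ (n + 1) ψ Qm k k' - (klMemberArrayF L M β U μ n χ Qm * Nm) k k'‖ ≤ E k k' := by
  obtain ⟨hdA, hcA, hA1, hA0⟩ := klmf_memberArray_flowData L M β U μ (klFlowFrameU L M β U μ (n + 1)) n ψ Qm hZ (A Qm) (A' Qm)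
    (by rw [hAdef]) (by rw [hA'def])
  obtain ⟨hdb, hcb, hbe⟩ := klmf_rung_data L M β μ (klFlowFrameU L M β U μ (n + 1)) n ψ Qm (b Qm) (b' Qm) (by rw [hbdef]) (by rw [hb'def])
  have hΓ1 : A Qm 1 = klMemberArrayF L M β U μ (n + 1) ψ Qm := by rw [hA1]; rfl
  have hΓ00 : ∀ x y, ¬(x ∈ klBall L μ 0 ∧ y ∈ klBall L μ 0) → A Qm 0 x y = 0 := fun x y hxy => by
    rw [hA0, Matrix.of_apply, if_neg hxy]
  exact kltc_tower_recentred (klBall L μ 0) (klMemberArrayF L M β U μ n χ Qm) (klMemberArrayF L M β U μ (n + 1) ψ Qm) (A Qm) (A' Qm)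
    (fun t => A' Qm t + A Qm t * diagonal (b' Qm t) * A Qm t) (b Qm) (b' Qm)
    (fun p => klSliceWeightSmeared L M β μ (klFlowFrameU L M β U μ (n + 1)) (n + 1) ψ Qm p) ρ η I E hm hr'
    (fun x y h => klMemberArrayF_eq_zero_off β U μ n χ Qm h) (fun x y h => klMemberArrayF_eq_zero_off β U μ (n + 1) ψ Qm h)
    hΓ00 hΓ1 hdA hdb hcA hcb (fun t _ => rfl) hAm hXm hV hsm hbe hη0
    (fun k _ k' _ => by simpa only [Matrix.sub_apply] using hη k k') hηe hsm₁ hI hE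

end Keyed

/-! ## §2 The tower weight's mass and sign lines in `htower`'s shape -/

section Lines

variable {L M : ℕ} [NeZero L] {R : RenConsts} {N : ℕ} (β μ : ℝ) {U : ℝ} (K : TrigPolyC4v)

/-- **MASS LINE, `htower` shape**: `Σ_p |w₁ p| ≤ ¾·G.bhi` for the smeared slice weight of an admissible member at scale `n+1`, as soon as `2¹⁹ ≤ G.bhi`. -/
theorem klmt_sliceWeight_massLine (hK : FrameOK R U N μ K) (hβ : klBetaMin ≤ β) (hβL : β ≤ L) (n : ℕ)
    {φ : FreqMomentum L M → ℝ} (hφ : ∀ k, 0 ≤ φ k ∧ φ k ≤ 1 - hubbardCutoffWeightCT L M β μ K (klScale klE0 (n + 1)) k)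
    {G : GeoConsts} (hG : (2 : ℝ) ^ 19 ≤ G.bhi) (Qm : TorusSite 2 L) :
    ∑ p, |klSliceWeightSmeared L M β μ K (n + 1) φ Qm p| ≤ 3 / 4 * G.bhi :=
  (sum_abs_klSliceWeightSmeared_succ_le β μ K hK hβ hβL n hφ Qm).trans (by nlinarith)

/-- **SIGN LINE, `htower` shape (no factor 2)**: `Σ_p (|w₁ p| − w₁ p) ≤ klEdge G (n+1) |Qm|_𝕋` for the smeared slice weight of an admissible member at scale `n+1`, as
soon as `2¹⁹ ≤ G.bhi`: deep inside the class the weight is nonnegative; elsewhere `klEdge = G.bhi ≥ 2·2¹⁸`. -/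
theorem klmt_sliceWeight_signLine (hK : FrameOK R U N μ K) (hβ : klBetaMin ≤ β) (hβL : β ≤ L) (n : ℕ)
    {φ : FreqMomentum L M → ℝ} (hφ : ∀ k, 0 ≤ φ k ∧ φ k ≤ 1 - hubbardCutoffWeightCT L M β μ K (klScale klE0 (n + 1)) k)
    {G : GeoConsts} (hG : (2 : ℝ) ^ 19 ≤ G.bhi) (Qm : TorusSite 2 L) :
    ∑ p, (|klSliceWeightSmeared L M β μ K (n + 1) φ Qm p| - klSliceWeightSmeared L M β μ K (n + 1) φ Qm p) ≤
      klEdge G (n + 1) (klTorusNorm L Qm) := by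
  by_cases h : klEdgeKappa * klTorusNorm L Qm ≤ klScale klE0 (n + 1)
  · rw [kled_sum_abs_sub_self_eq_zero (fun p => klSliceWeightSmeared_succ_nonneg_of_deep β μ K hK (pos_of_klBetaMin_le hβ) n
      (fun k => (hφ k).1) h p)]
    exact klEdge_nonneg (le_trans (by positivity) hG) (n + 1) (KLProgrammeLegKernels.torusSupNorm_nonneg _)
  · rw [klEdge_eq_bhi_of_le G (not_le.mp h).le]
    have h1 := kled_sum_abs_sub_self_le (fun p => klSliceWeightSmeared L M β μ K (n + 1) φ Qm p)
    have h2 := sum_abs_klSliceWeightSmeared_succ_le β μ K hK hβ hβL n hφ Qm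
    linarith

end Lines

/-! ## §3 The `htower` package of the PLAIN member (keying `(n, n+1)`) -/

section Plain

variable (L M : ℕ) [NeZero L] [NeZero M]

set_option maxHeartbeats 1600000 in -- long pinning equations + fourteen-conjunct package
/-- **`klmt_htower_plain`** — `htower` of `EngineV8.pairLadderStepAtV17F2_of_relFamilyK5(_klCT8)` at keying `(n, n+1)`, BAR `Tb` and SLOT `Bar` generic, for the PLAIN
member (`ψ = 0`) with history `s^(Kₙ)_(n,n+1)`: from the tower sizes of `klmt_memberTower_keyed` and the consumer-side rows, the fourteen conjuncts VERBATIM — the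
X-rows, `0 ≤ Ea`, the Neumann identity, the error row, the mass and the sign line are DISCHARGED here. -/
theorem klmt_htower_plain {β U μ : ℝ} {n N : ℕ} {m : ℝ} (hm : 0 ≤ m) {Rn : RenConsts} {G : GeoConsts}
    (hK : FrameOK Rn U N μ (klFlowFrameU L M β U μ (n + 1))) (hβ : klBetaMin ≤ β) (hβL : β ≤ L) (hG : (2 : ℝ) ^ 19 ≤ G.bhi)
    (hZ : ∀ Λ ∈ Icc (klScale klE0 (n + 1)) (klScale klE0 n), hubbardEffPartitionFnCT L M β U μ 0 (klFlowFrameU L M β U μ (n + 1)) Λ ≠ 0)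
    (A A' : TorusSite 2 L → ℝ → Matrix (TorusSite 2 L) (TorusSite 2 L) ℂ) (b b' : TorusSite 2 L → ℝ → TorusSite 2 L → ℂ)
    (hAdef : A = fun Qm t => Matrix.of fun k k' : TorusSite 2 L => if k ∈ klBall L μ 0 ∧ k' ∈ klBall L μ 0 then
      vertexFn L M β (gaussConv ℂ
        (softCovOf L M β μ (klFlowFrameU L M β U μ (n + 1)) (fun _ => (0 : ℝ)) + hubbardCovAboveCT L M β μ 0 (klFlowFrameU L M β U μ (n + 1)) (klScale klE0 (n + 1)) -
          hubbardCovAboveCT L M β μ 0 (klFlowFrameU L M β U μ (n + 1)) (klScale klE0 n + t * (klScale klE0 (n + 1) - klScale klE0 n)))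
        (hubbardEffectiveActionCT L M β U μ 0 (klFlowFrameU L M β U μ (n + 1)) (klScale klE0 n + t * (klScale klE0 (n + 1) - klScale klE0 n)))) 4
        ![(((omega0 M, k'), 0), 0), ((((omega0 M).rev, Qm - k'), 1), 0), ((((omega0 M).rev, Qm - k), 1), 1), (((omega0 M, k), 0), 1)]
      else 0)
    (hA'def : A' = fun Qm t => Matrix.of fun k k' : TorusSite 2 L => if k ∈ klBall L μ 0 ∧ k' ∈ klBall L μ 0 then
      (klScale klE0 (n + 1) - klScale klE0 n) • -((2 : ℂ)⁻¹ * vertexFn L M β (gaussConv ℂ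
        (softCovOf L M β μ (klFlowFrameU L M β U μ (n + 1)) (fun _ => (0 : ℝ)) + hubbardCovAboveCT L M β μ 0 (klFlowFrameU L M β U μ (n + 1)) (klScale klE0 (n + 1)) -
          hubbardCovAboveCT L M β μ 0 (klFlowFrameU L M β U μ (n + 1)) (klScale klE0 n + t * (klScale klE0 (n + 1) - klScale klE0 n)))
        (grassmannDerivPairing ℂ
          (Matrix.of fun X Y : HubbardFieldIdx L M => deriv (fun Λ'' : ℝ => hubbardCovAboveCT L M β μ 0 (klFlowFrameU L M β U μ (n + 1)) Λ'' X Y)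
            (klScale klE0 n + t * (klScale klE0 (n + 1) - klScale klE0 n)))
          (hubbardEffectiveActionCT L M β U μ 0 (klFlowFrameU L M β U μ (n + 1)) (klScale klE0 n + t * (klScale klE0 (n + 1) - klScale klE0 n)))
          (hubbardEffectiveActionCT L M β U μ 0 (klFlowFrameU L M β U μ (n + 1)) (klScale klE0 n + t * (klScale klE0 (n + 1) - klScale klE0 n))))) 4
        ![(((omega0 M, k'), 0), 0), ((((omega0 M).rev, Qm - k'), 1), 0), ((((omega0 M).rev, Qm - k), 1), 1), (((omega0 M, k), 0), 1)])
      else 0)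
    (hbdef : b = fun Qm t p => -((klBubbleMass L M β μ (klFlowFrameU L M β U μ (n + 1))
        (fun k => (0 : ℝ) + (hubbardCutoffWeightCT L M β μ (klFlowFrameU L M β U μ (n + 1)) (klScale klE0 (n + 1)) k -
          hubbardCutoffWeightCT L M β μ (klFlowFrameU L M β U μ (n + 1)) (klScale klE0 n + t * (klScale klE0 (n + 1) - klScale klE0 n)) k))
        (fun k => (0 : ℝ) + (hubbardCutoffWeightCT L M β μ (klFlowFrameU L M β U μ (n + 1)) (klScale klE0 (n + 1)) k -
          hubbardCutoffWeightCT L M β μ (klFlowFrameU L M β U μ (n + 1)) (klScale klE0 n + t * (klScale klE0 (n + 1) - klScale klE0 n)) k)) Qm p : ℝ) : ℂ))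
    (hb'def : b' = fun Qm t p => (((klScale klE0 (n + 1) - klScale klE0 n) *
        (klBubbleMass L M β μ (klFlowFrameU L M β U μ (n + 1))
            (fun k => deriv (fun Λ' => hubbardCutoffWeightCT L M β μ (klFlowFrameU L M β U μ (n + 1)) Λ' k) (klScale klE0 n + t * (klScale klE0 (n + 1) - klScale klE0 n)))
            (fun k => (0 : ℝ) + (hubbardCutoffWeightCT L M β μ (klFlowFrameU L M β U μ (n + 1)) (klScale klE0 (n + 1)) k -
          hubbardCutoffWeightCT L M β μ (klFlowFrameU L M β U μ (n + 1)) (klScale klE0 n + t * (klScale klE0 (n + 1) - klScale klE0 n)) k)) Qm p +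
          klBubbleMass L M β μ (klFlowFrameU L M β U μ (n + 1))
            (fun k => (0 : ℝ) + (hubbardCutoffWeightCT L M β μ (klFlowFrameU L M β U μ (n + 1)) (klScale klE0 (n + 1)) k -
          hubbardCutoffWeightCT L M β μ (klFlowFrameU L M β U μ (n + 1)) (klScale klE0 n + t * (klScale klE0 (n + 1) - klScale klE0 n)) k))
            (fun k => deriv (fun Λ' => hubbardCutoffWeightCT L M β μ (klFlowFrameU L M β U μ (n + 1)) Λ' k) (klScale klE0 n + t * (klScale klE0 (n + 1) - klScale klE0 n)))
            Qm p) : ℝ) : ℂ))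
    (Tb Bar : TorusSite 2 L → TorusSite 2 L → TorusSite 2 L → ℝ)
    (hdata : ∀ Qm : TorusSite 2 L, IsPairClassAt L Qm (n + 1) →
      ∃ (r' e₁ : ℝ) (ρ : TorusSite 2 L → ℝ) (η I Ea E₁ : TorusSite 2 L → TorusSite 2 L → ℝ), 0 ≤ r' ∧ 0 ≤ e₁ ∧
        -- tower sizes (`klmt_memberTower_keyed`)
        (∀ t ∈ Icc (0 : ℝ) 1, ∀ x y, ‖A Qm t x y‖ ≤ m) ∧
        (∀ c, (∫ τ in (0 : ℝ)..1, ‖b' Qm τ c‖) ≤ ρ c) ∧ 3 / 2 * m * ∑ c, ρ c ≤ 1 / 3 ∧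
        (∀ x y, ‖klMemberArrayF L M β U μ n (softSymbolCompl L M β μ (klFlowFrameU L M β U μ n) n (n + 1)) Qm x y‖ ≤ m) ∧
        (∀ x y, 0 ≤ η x y) ∧ (∀ x y, ‖(A Qm 0 - klMemberArrayF L M β U μ n (softSymbolCompl L M β μ (klFlowFrameU L M β U μ n) n (n + 1)) Qm) x y‖ ≤ η x y) ∧ (∀ x y, η x y ≤ r') ∧
        (3 / 2 * m + r') * ∑ p, |klSliceWeightSmeared L M β μ (klFlowFrameU L M β U μ (n + 1)) (n + 1) (fun _ => (0 : ℝ)) Qm p| ≤ 1 / 3 ∧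
        (∀ x y, (∫ t in (0 : ℝ)..1, ‖(A' Qm t + A Qm t * diagonal (b' Qm t) * A Qm t) x y‖) ≤ I x y) ∧
        (∀ x y,
          (I x y + 3 / 2 * (3 / 2 * m) * ∑ c, I x c * ρ c + 3 / 2 * m * ∑ a, ρ a * I a y +
            9 / 4 * m * (3 / 2 * m) * ∑ a, ∑ c, ρ a * I a c * ρ c) +
            (η x y + 3 / 2 * (3 / 2 * m) * ∑ t, η x t * |klSliceWeightSmeared L M β μ (klFlowFrameU L M β U μ (n + 1)) (n + 1) (fun _ => (0 : ℝ)) Qm t| + 3 / 2 * (3 / 2 * m + r') * ∑ a, |klSliceWeightSmeared L M β μ (klFlowFrameU L M β U μ (n + 1)) (n + 1) (fun _ => (0 : ℝ)) Qm a| * η a y +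
            9 / 4 * (3 / 2 * m + r') * (3 / 2 * m) * ∑ a, ∑ t, |klSliceWeightSmeared L M β μ (klFlowFrameU L M β U μ (n + 1)) (n + 1) (fun _ => (0 : ℝ)) Qm a| * η a t * |klSliceWeightSmeared L M β μ (klFlowFrameU L M β U μ (n + 1)) (n + 1) (fun _ => (0 : ℝ)) Qm t|) ≤ Ea x y) ∧
        -- consumer-side rows at the bar `Tb Qm` and the slot `Bar Qm`
        (∀ x y, Tb Qm x y ≤ r') ∧
        (∀ x y, Ea x y + (Tb Qm x y + 3 / 2 * (3 / 2 * m) * ∑ t, Tb Qm x t * |klSliceWeightSmeared L M β μ (klFlowFrameU L M β U μ (n + 1)) (n + 1) (fun _ => (0 : ℝ)) Qm t| + 3 / 2 * (3 / 2 * m + r') * ∑ a, |klSliceWeightSmeared L M β μ (klFlowFrameU L M β U μ (n + 1)) (n + 1) (fun _ => (0 : ℝ)) Qm a| * Tb Qm a y +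
            9 / 4 * (3 / 2 * m + r') * (3 / 2 * m) * ∑ a, ∑ t, |klSliceWeightSmeared L M β μ (klFlowFrameU L M β U μ (n + 1)) (n + 1) (fun _ => (0 : ℝ)) Qm a| * Tb Qm a t * |klSliceWeightSmeared L M β μ (klFlowFrameU L M β U μ (n + 1)) (n + 1) (fun _ => (0 : ℝ)) Qm t|) ≤ E₁ x y) ∧
        (∀ x y, E₁ x y ≤ e₁) ∧
        (∀ k ∈ klBall L μ 0, ∀ k' ∈ klBall L μ 0, E₁ k k' ≤ Bar Qm k k')) :
    ∀ Qm : TorusSite 2 L, IsPairClassAt L Qm (n + 1) →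
      ∃ (X Nm : Matrix (TorusSite 2 L) (TorusSite 2 L) ℂ) (w₁ : TorusSite 2 L → ℝ) (Ea E₁ : TorusSite 2 L → TorusSite 2 L → ℝ) (r' e₁ : ℝ),
        0 ≤ r' ∧ 0 ≤ e₁ ∧
        (∀ x y, ¬(x ∈ klBall L μ 0 ∧ y ∈ klBall L μ 0) → X x y = 0) ∧
        (∀ k ∈ klBall L μ 0, ∀ k' ∈ klBall L μ 0,
          X k k' = klCovSmearedPairAmplitude L M β U μ (klFlowFrameU L M β U μ n) n
            (softCovOf L M β μ (klFlowFrameU L M β U μ n) (softSymbolCompl L M β μ (klFlowFrameU L M β U μ n) n (n + 1))) Qm k k') ∧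
        (∀ x y, 0 ≤ Ea x y) ∧
        (1 + Matrix.diagonal (fun p => (w₁ p : ℂ)) * X) * Nm = 1 ∧
        (∀ k ∈ klBall L μ 0, ∀ k' ∈ klBall L μ 0, ‖klPairArrayF L M β U μ (n + 1) Qm k k' - (X * Nm) k k'‖ ≤ Ea k k') ∧
        (∀ x y, Tb Qm x y ≤ r') ∧
        (∀ x y, Ea x y + (Tb Qm x y + 3 / 2 * (3 / 2 * m) * ∑ t, Tb Qm x t * |w₁ t| + 3 / 2 * (3 / 2 * m + r') * ∑ a, |w₁ a| * Tb Qm a y +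
            9 / 4 * (3 / 2 * m + r') * (3 / 2 * m) * ∑ a, ∑ t, |w₁ a| * Tb Qm a t * |w₁ t|) ≤ E₁ x y) ∧
        (∀ x y, E₁ x y ≤ e₁) ∧
        (3 / 2 * m + r') * ∑ a, |w₁ a| ≤ 1 / 3 ∧
        (∑ p, |w₁ p| ≤ 3 / 4 * G.bhi) ∧
        (∑ p, (|w₁ p| - w₁ p) ≤ klEdge G (n + 1) (klTorusNorm L Qm)) ∧
        (∀ k ∈ klBall L μ 0, ∀ k' ∈ klBall L μ 0, E₁ k k' ≤ Bar Qm k k') := by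
  intro Qm hQm
  obtain ⟨r', e₁, ρ, η, I, Ea, E₁, hr', he₁, hAm, hV, hsm, hXm, hη0, hη, hηe, hsm₁, hI, hEa, hTb, hE₁, hE₁e, hbar⟩ := hdata Qm hQm
  obtain ⟨Nm, hN1, -, herr⟩ := klmt_memberTower_keyed L M hm (ψ := fun _ => (0 : ℝ))
    (χ := softSymbolCompl L M β μ (klFlowFrameU L M β U μ n) n (n + 1)) hZ A A' b b' hAdef hA'def hbdef hb'def Qm hr' ρ η I Ea
    hAm hV hsm hXm hη0 hη hηe hsm₁ hI hEa
  have hφ := (isSoftSymbol_zero (L := L) (M := M) β μ (klFlowFrameU L M β U μ (n + 1)) (n + 1)).1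
  have hEa0 : ∀ x y, 0 ≤ Ea x y := fun x y => by
    have hkk := herr
    -- `Ea` dominates a sum of nonnegative terms (the source four-term + the re-centring four-term)
    refine le_trans ?_ (hEa x y)
    have hρ0 : ∀ c, 0 ≤ ρ c := fun c => (intervalIntegral.integral_nonneg zero_le_one fun τ _ => norm_nonneg _).trans (hV c)
    have hI0 : ∀ x y, 0 ≤ I x y := fun x y => (intervalIntegral.integral_nonneg zero_le_one fun t _ => norm_nonneg _).trans (hI x y)
    have hw0 : ∀ a, 0 ≤ |klSliceWeightSmeared L M β μ (klFlowFrameU L M β U μ (n + 1)) (n + 1) (fun _ => (0 : ℝ)) Qm a| := fun a => abs_nonneg _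
    have h2 : 0 ≤ ∑ c, I x c * ρ c := sum_nonneg fun c _ => mul_nonneg (hI0 x c) (hρ0 c)
    have h3 : 0 ≤ ∑ a, ρ a * I a y := sum_nonneg fun a _ => mul_nonneg (hρ0 a) (hI0 a y)
    have h4 : 0 ≤ ∑ a, ∑ c, ρ a * I a c * ρ c := sum_nonneg fun a _ => sum_nonneg fun c _ => mul_nonneg (mul_nonneg (hρ0 a) (hI0 a c)) (hρ0 c)
    have h5 : 0 ≤ ∑ t, η x t * |klSliceWeightSmeared L M β μ (klFlowFrameU L M β U μ (n + 1)) (n + 1) (fun _ => (0 : ℝ)) Qm t| := sum_nonneg fun t _ => mul_nonneg (hη0 x t) (hw0 t)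
    have h6 : 0 ≤ ∑ a, |klSliceWeightSmeared L M β μ (klFlowFrameU L M β U μ (n + 1)) (n + 1) (fun _ => (0 : ℝ)) Qm a| * η a y := sum_nonneg fun a _ => mul_nonneg (hw0 a) (hη0 a y)
    have h7 : 0 ≤ ∑ a, ∑ t, |klSliceWeightSmeared L M β μ (klFlowFrameU L M β U μ (n + 1)) (n + 1) (fun _ => (0 : ℝ)) Qm a| * η a t * |klSliceWeightSmeared L M β μ (klFlowFrameU L M β U μ (n + 1)) (n + 1) (fun _ => (0 : ℝ)) Qm t| := sum_nonneg fun a _ => sum_nonneg fun t _ => mul_nonneg (mul_nonneg (hw0 a) (hη0 a t)) (hw0 t)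
    have := hI0 x y
    have := hη0 x y
    positivity
  refine ⟨klMemberArrayF L M β U μ n (softSymbolCompl L M β μ (klFlowFrameU L M β U μ n) n (n + 1)) Qm, Nm, fun p => klSliceWeightSmeared L M β μ (klFlowFrameU L M β U μ (n + 1)) (n + 1) (fun _ => (0 : ℝ)) Qm p, Ea, E₁, r', e₁, hr', he₁,
    fun x y h => klMemberArrayF_eq_zero_off β U μ n _ Qm h,
    fun k hk k' hk' => klMemberArrayF_apply_of_mem β U μ n _ Qm hk hk', hEa0, hN1, fun k hk k' hk' => ?_, hTb, hE₁, hE₁e, hsm₁,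
    klmt_sliceWeight_massLine β μ (klFlowFrameU L M β U μ (n + 1)) hK hβ hβL n hφ hG Qm,
    klmt_sliceWeight_signLine β μ (klFlowFrameU L M β U μ (n + 1)) hK hβ hβL n hφ hG Qm, hbar⟩
  rw [← klMemberArrayF_zero]
  exact herr k hk k' hk'

end Plain

end Summit.HubbardSuperconductivity.HubbardSuperconductivity.Theorems.KLRegimeSplit

end
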